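import Summits.Langlands.Langlands.Theorems.DisagreementBeurlingDefectTable36Group
import HarnessLib

/-!
# DisagreementBeurling — `DefectTable36`, part 2: inversion by `x²` and fourth powers

Continuation of part 1 (`DisagreementBeurlingDefectTable36Group`): for a finite group `H` with
`|H| = 36`, `Z(H) = 1`, a normal subgroup `P` of order `9` and an element `x` of order `4`,

* §2' conjugation by `x²` inverts `P`: a fixed point `c ≠ 1` of `x²` on `P` would make the
  subgroup `I` of `x²`-inverted elements of `P` have order `3`; `I` is stable under conjugation
  by `x`, so `x` acts on the cyclic group `I = ⟨d⟩` and `x²` acts trivially on it — but `x²`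
  inverts `d ≠ 1`; and no fixed point forces inversion since `|P|` is odd;
* §3 consequently every element of `H` outside `P` has order dividing `4`
  (`(xʲ p)⁴ = 1` from the relation `x² p = p⁻¹ x²`).

No named facts are assumed. [folklore]
-/

set_option linter.dupNamespace false

namespace Summit.Langlands.Langlands.Theorems.DisagreementBeurlingDefectTable36

variable {H : Type*} [Group H]

/-! ### §2' Conjugation by `x²` inverts the normal subgroup of order `9` -/

section Inversion

/-- **Inversion.**  If `|H| = 36`, `Z(H) = 1`, `P ⊴ H` has order `9` and `x` has order `4`, then
conjugation by `x²` inverts every element of `P`. [folklore] -/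
theorem conj_sq_eq_inv [Finite H] (h36 : Nat.card H = 36) (hZ : Subgroup.center H = ⊥)
    {P : Subgroup H} (hN : P.Normal) (hP9 : Nat.card P = 9) {x : H} (hx : orderOf x = 4) :
    ∀ p ∈ P, x ^ 2 * p * (x ^ 2)⁻¹ = p⁻¹ := by
  have hx4 : x ^ 4 = 1 := by rw [← hx]; exact pow_orderOf_eq_one x
  have hwP : ∀ p ∈ P, x ^ 2 * p * (x ^ 2)⁻¹ ∈ P := fun p hp => hN.conj_mem p hp (x ^ 2)
  have hyP : ∀ p ∈ P, x * p * x⁻¹ ∈ P := fun p hp => hN.conj_mem p hp x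
  have hwmul : ∀ p q : H, x ^ 2 * (p * q) * (x ^ 2)⁻¹ =
      (x ^ 2 * p * (x ^ 2)⁻¹) * (x ^ 2 * q * (x ^ 2)⁻¹) := by
    intros; group
  have hwinv : ∀ p : H, x ^ 2 * p⁻¹ * (x ^ 2)⁻¹ = (x ^ 2 * p * (x ^ 2)⁻¹)⁻¹ := by
    intros; group
  have hww : ∀ p : H, x ^ 2 * (x ^ 2 * p * (x ^ 2)⁻¹) * (x ^ 2)⁻¹ = p := by
    intro p
    calc _ = x ^ 4 * p * (x ^ 4)⁻¹ := by group
      _ = p := by rw [hx4]; group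
  -- Step 1: it suffices that conjugation by `x²` has no fixed point in `P` other than `1`
  suffices hfix : ∀ c ∈ P, x ^ 2 * c * (x ^ 2)⁻¹ = c → c = 1 by
    intro p hp
    have hd : x ^ 2 * (p * (x ^ 2 * p * (x ^ 2)⁻¹)) * (x ^ 2)⁻¹ = p * (x ^ 2 * p * (x ^ 2)⁻¹) := by
      rw [hwmul, hww]
      exact comm_of_card_eq_nine hP9 (hwP p hp) hp
    exact eq_inv_of_mul_eq_one_right (hfix _ (P.mul_mem hp (hwP p hp)) hd)
  intro c hc hwc
  by_contra hc1
  -- Step 2: conjugation by `x²` is not the identity on `P` (else `x²` would be central)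
  have hnotid : ∃ p₀ ∈ P, x ^ 2 * p₀ * (x ^ 2)⁻¹ ≠ p₀ := by
    by_contra hall
    push Not at hall
    have hcen : x ^ 2 ∈ Subgroup.center H := by
      rw [Subgroup.mem_center_iff]
      intro h
      obtain ⟨k, p, hp, rfl⟩ := exists_zpow_mul h36 hN hP9 hx h
      have hpx : p * x ^ 2 = x ^ 2 * p := by
        calc p * x ^ 2 = (x ^ 2 * p * (x ^ 2)⁻¹) * x ^ 2 := by rw [hall p hp]
          _ = x ^ 2 * p := by group
      calc x ^ k * p * x ^ 2 = x ^ k * (p * x ^ 2) := by group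
        _ = x ^ k * (x ^ 2 * p) := by rw [hpx]
        _ = x ^ 2 * (x ^ k * p) := by group
    rw [hZ, Subgroup.mem_bot] at hcen
    have := orderOf_dvd_of_pow_eq_one hcen
    rw [hx] at this
    omega
  obtain ⟨p₀, hp₀, hwp₀⟩ := hnotid
  -- `d := p₀ (x² p₀ x⁻²)⁻¹ ≠ 1` is inverted by `x²`
  set d : H := p₀ * (x ^ 2 * p₀ * (x ^ 2)⁻¹)⁻¹ with hd_def
  have hdP : d ∈ P := P.mul_mem hp₀ (P.inv_mem (hwP p₀ hp₀))
  have hd1 : d ≠ 1 := fun h => hwp₀ (mul_inv_eq_one.mp h).symm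
  have hwd : x ^ 2 * d * (x ^ 2)⁻¹ = d⁻¹ := by
    rw [hd_def, hwmul, hwinv, hww, mul_inv_rev, inv_inv]
  -- the subgroup `I` of elements of `P` inverted by `x²`
  let I : Subgroup H :=
    { carrier := {p | p ∈ P ∧ x ^ 2 * p * (x ^ 2)⁻¹ = p⁻¹}
      mul_mem' := by
        rintro a b ⟨ha, hwa⟩ ⟨hb, hwb⟩
        refine ⟨P.mul_mem ha hb, ?_⟩
        rw [hwmul, hwa, hwb, mul_inv_rev]
        exact comm_of_card_eq_nine hP9 (P.inv_mem ha) (P.inv_mem hb)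
      one_mem' := ⟨P.one_mem, by group⟩
      inv_mem' := by
        rintro a ⟨ha, hwa⟩
        exact ⟨P.inv_mem ha, by rw [hwinv, hwa]⟩ }
  have hmemI : ∀ p : H, p ∈ I ↔ p ∈ P ∧ x ^ 2 * p * (x ^ 2)⁻¹ = p⁻¹ := fun p => Iff.rfl
  have hIP : I ≤ P := fun p hp => ((hmemI p).mp hp).1
  have hdI : d ∈ I := (hmemI d).mpr ⟨hdP, hwd⟩
  -- `c ∉ I` (an element both fixed and inverted is trivial, `|P|` being odd)
  have hcI : c ∉ I := by
    intro hcI'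
    have hwc' := ((hmemI c).mp hcI').2
    have hcc : c = c⁻¹ := hwc.symm.trans hwc'
    have hc2 : c ^ 2 = 1 := by rw [pow_two]; exact mul_eq_one_iff_eq_inv.mpr hcc
    have h2 := orderOf_dvd_of_pow_eq_one hc2
    have h9 := orderOf_dvd_of_pow_eq_one (pow_nine_eq_one_of_mem hP9 hc)
    have h1 : orderOf c ∣ Nat.gcd 2 9 := Nat.dvd_gcd h2 h9
    have h1' : orderOf c = 1 := by
      have : Nat.gcd 2 9 = 1 := by decide
      rw [this] at h1
      exact Nat.dvd_one.mp h1
    exact hc1 (orderOf_eq_one_iff.mp h1')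
  -- hence `|I| = 3`
  have hIcard : Nat.card I ∣ 9 := hP9 ▸ Subgroup.card_dvd_of_le hIP
  have hI9 : Nat.card I ≠ 9 := by
    intro h9
    have hIeq : I = P := Subgroup.eq_of_le_of_card_ge hIP (by rw [h9, hP9])
    apply hcI
    rw [hIeq]
    exact hc
  have hI1 : Nat.card I ≠ 1 := by
    intro h1
    have hIbot : I = ⊥ := Subgroup.eq_bot_of_card_eq I h1
    have := hdI
    rw [hIbot, Subgroup.mem_bot] at this
    exact hd1 this
  have hI3 : Nat.card I = 3 := by
    have h' : Nat.card I ∣ 3 ^ 2 := by simpa using hIcard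
    obtain ⟨k, hk, hkI⟩ := (Nat.dvd_prime_pow Nat.prime_three).mp h'
    interval_cases k
    · exact absurd (by simpa using hkI) hI1
    · simpa using hkI
    · exact absurd (by simpa using hkI) hI9
  -- `d` has order `3` and generates `I`
  have hod : orderOf d = 3 := by
    have h3 : orderOf d ∣ 3 := by
      have := orderOf_dvd_natCard (⟨d, hdI⟩ : I)
      rwa [hI3, Subgroup.orderOf_mk] at this
    rcases (Nat.dvd_prime Nat.prime_three).mp h3 with h | h
    · exact absurd (orderOf_eq_one_iff.mp h) hd1
    · exact h
  have hzp : Subgroup.zpowers d = I := by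
    apply Subgroup.eq_of_le_of_card_ge
    · rw [Subgroup.zpowers_le]
      exact hdI
    · rw [hI3, Nat.card_zpowers, hod]
  -- `x d x⁻¹ ∈ I`, so `x d x⁻¹ = dʲ` with `j < 3`
  have hydI : x * d * x⁻¹ ∈ I := by
    refine (hmemI _).mpr ⟨hyP d hdP, ?_⟩
    calc x ^ 2 * (x * d * x⁻¹) * (x ^ 2)⁻¹ = x * (x ^ 2 * d * (x ^ 2)⁻¹) * x⁻¹ := by group
      _ = x * d⁻¹ * x⁻¹ := by rw [hwd]
      _ = (x * d * x⁻¹)⁻¹ := by group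
  have hyd_mem : x * d * x⁻¹ ∈ Subgroup.zpowers d := by
    rw [hzp]
    exact hydI
  classical
  rw [mem_zpowers_iff_mem_range_orderOf, hod, Finset.mem_image] at hyd_mem
  obtain ⟨j, hj, hjd⟩ := hyd_mem
  rw [Finset.mem_range] at hj
  have hd3 : d ^ 3 = 1 := by rw [← hod]; exact pow_orderOf_eq_one d
  have hwd' : x ^ 2 * d * (x ^ 2)⁻¹ = x * (x * d * x⁻¹) * x⁻¹ := by
    simp only [pow_two, mul_assoc, mul_inv_rev]
  -- in each case conjugation by `x²` fixes `d`, contradicting `x² d x⁻² = d⁻¹ ≠ d`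
  have hfixd : x ^ 2 * d * (x ^ 2)⁻¹ ≠ d := by
    rw [hwd]
    intro h
    have hd2 : d ^ 2 = 1 := by rw [pow_two]; exact mul_eq_one_iff_eq_inv.mpr h.symm
    apply hd1
    calc d = d ^ 3 * (d ^ 2)⁻¹ := by group
      _ = 1 := by rw [hd3, hd2]; group
  interval_cases j
  · rw [pow_zero] at hjd
    apply hd1
    calc d = x⁻¹ * (x * d * x⁻¹) * x := by group
      _ = 1 := by rw [← hjd]; group
  · rw [pow_one] at hjd
    apply hfixd
    rw [hwd', ← hjd, ← hjd]
  · apply hfixd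
    calc x ^ 2 * d * (x ^ 2)⁻¹ = x * (x * d * x⁻¹) * x⁻¹ := hwd'
      _ = x * d ^ 2 * x⁻¹ := by rw [← hjd]
      _ = (x * d * x⁻¹) ^ 2 := by
        rw [pow_two, pow_two]
        simp only [mul_assoc, inv_mul_cancel_left]
      _ = (d ^ 2) ^ 2 := by rw [← hjd]
      _ = d ^ 3 * d := by group
      _ = d := by rw [hd3, one_mul]

end Inversion

/-! ### §3 Elements outside the normal subgroup of order `9` have order dividing `4` -/

section Fourth

/-- **Fourth powers.**  If `|H| = 36`, `Z(H) = 1`, `P ⊴ H` has order `9` and `H` has an element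
of order `4`, then `h⁴ = 1` for every `h ∉ P`. [folklore] -/
theorem pow_four_eq_one_of_not_mem [Finite H] (h36 : Nat.card H = 36)
    (hZ : Subgroup.center H = ⊥) {P : Subgroup H} (hN : P.Normal) (hP9 : Nat.card P = 9)
    {x : H} (hx : orderOf x = 4) {h : H} (hh : h ∉ P) : h ^ 4 = 1 := by
  have hx4 : x ^ 4 = 1 := by rw [← hx]; exact pow_orderOf_eq_one x
  have hinv := conj_sq_eq_inv h36 hZ hN hP9 hx
  have hrel : ∀ r ∈ P, x ^ 2 * r = r⁻¹ * x ^ 2 := fun r hr => by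
    calc x ^ 2 * r = (x ^ 2 * r * (x ^ 2)⁻¹) * x ^ 2 := by group
      _ = r⁻¹ * x ^ 2 := by rw [hinv r hr]
  have hsq : ∀ r ∈ P, (r * x ^ 2) * (r * x ^ 2) = 1 := fun r hr => by
    calc (r * x ^ 2) * (r * x ^ 2) = r * (x ^ 2 * r) * x ^ 2 := by group
      _ = r * (r⁻¹ * x ^ 2) * x ^ 2 := by rw [hrel r hr]
      _ = x ^ 4 := by group
      _ = 1 := hx4
  obtain ⟨n, p, hn4, hp, rfl⟩ := exists_pow_mul h36 hN hP9 hx h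
  interval_cases n
  · exact absurd (by simpa using hp) hh
  · rw [pow_one]
    have hq : x * p * x⁻¹ * p⁻¹ ∈ P := P.mul_mem (hN.conj_mem p hp x) (P.inv_mem hp)
    have h2 : (x * p) ^ 2 = (x * p * x⁻¹ * p⁻¹) * x ^ 2 := by
      calc (x * p) ^ 2 = (x * p * x⁻¹) * (x ^ 2 * p) := by
            rw [pow_two, pow_two]
            simp only [mul_assoc, inv_mul_cancel_left]
        _ = (x * p * x⁻¹) * (p⁻¹ * x ^ 2) := by rw [hrel p hp]
        _ = _ := by group
    calc (x * p) ^ 4 = (x * p) ^ 2 * (x * p) ^ 2 := by group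
      _ = 1 := by rw [h2]; exact hsq _ hq
  · calc (x ^ 2 * p) ^ 4 = ((p⁻¹ * x ^ 2) * (p⁻¹ * x ^ 2)) * ((p⁻¹ * x ^ 2) * (p⁻¹ * x ^ 2)) := by
          rw [hrel p hp]
          simp only [pow_succ, pow_zero, one_mul, mul_assoc]
      _ = 1 := by rw [hsq _ (P.inv_mem hp), one_mul]
  · have hq : x ^ 3 * p * (x ^ 3)⁻¹ * p⁻¹ ∈ P :=
      P.mul_mem (hN.conj_mem p hp (x ^ 3)) (P.inv_mem hp)
    have hx6 : x ^ 6 = x ^ 2 := by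
      calc x ^ 6 = x ^ 4 * x ^ 2 := by group
        _ = x ^ 2 := by rw [hx4, one_mul]
    have h2 : (x ^ 3 * p) ^ 2 = (x ^ 3 * p * (x ^ 3)⁻¹ * p⁻¹) * x ^ 2 := by
      calc (x ^ 3 * p) ^ 2 = (x ^ 3 * p * (x ^ 3)⁻¹) * (x ^ 6 * p) := by
            rw [pow_two, show x ^ 6 = x ^ 3 * x ^ 3 by rw [← pow_add]]
            simp only [mul_assoc, inv_mul_cancel_left]
        _ = (x ^ 3 * p * (x ^ 3)⁻¹) * (x ^ 2 * p) := by rw [hx6]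
        _ = (x ^ 3 * p * (x ^ 3)⁻¹) * (p⁻¹ * x ^ 2) := by rw [hrel p hp]
        _ = _ := by group
    calc (x ^ 3 * p) ^ 4 = (x ^ 3 * p) ^ 2 * (x ^ 3 * p) ^ 2 := by group
      _ = 1 := by rw [h2]; exact hsq _ hq

/-- **Summary of part 1.**  A finite group of order `36` with trivial centre and an element of
order `4` has a normal subgroup `P` of order `9` such that every element outside `P` has order
dividing `4`. [folklore] -/
theorem exists_normal_nine_pow_four [Finite H] (h36 : Nat.card H = 36)
    (hZ : Subgroup.center H = ⊥) (h4 : ∃ x : H, orderOf x = 4) :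
    ∃ P : Subgroup H, P.Normal ∧ Nat.card P = 9 ∧ ∀ h : H, h ∉ P → h ^ 4 = 1 := by
  obtain ⟨P, hN, hP9⟩ := exists_normal_card_nine h36 hZ
  obtain ⟨x, hx⟩ := h4
  exact ⟨P, hN, hP9, fun h hh => pow_four_eq_one_of_not_mem h36 hZ hN hP9 hx hh⟩

end Fourth

end Summit.Langlands.Langlands.Theorems.DisagreementBeurlingDefectTable36
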